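import Summits.BirchSwinnertonDyer.BirchSwinnertonDyer.Theorems.KolyvaginRankRigidityAtTwoCorankOneCollapse
import Summits.BirchSwinnertonDyer.BirchSwinnertonDyer.Theorems.GenusKolyvaginAtTwoMinimalTwinBSDTwoOrdinaryTwist
import Summits.BirchSwinnertonDyer.Rank1Residual.X11b.TwistTransport
import Literature.NumberTheory.EllipticCurves.Castella2018.TamagawaQuadraticBaseChangeProofs
import Literature.NumberTheory.EllipticCurves.CyclotomicIwasawaMainTheoremIrreducibleBaseChangeProofs
import Literature.NumberTheory.EllipticCurves.HeegnerPointsKolyvaginExceptionalTwistProofs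
import Literature.NumberTheory.EllipticCurves.ComplexMultiplicationHasCMProofs
import Literature.NumberTheory.EllipticCurves.HeegnerPointsOfConductorOneRationalityProofs
import Literature.NumberTheory.EllipticCurves.HeegnerPointsOfConductorOneData
import Literature.NumberTheory.EllipticCurves.HeegnerPointsOfConductorOneGaloisConjProofs
import Literature.NumberTheory.EllipticCurves.BSDSelmerPConverseYanZhuKolyvaginSystemProofs
import Literature.NumberTheory.EllipticCurves.LeadingTermProofs
import Literature.NumberTheory.EllipticCurves.LFunctionSmulProofs
import Literature.NumberTheory.EllipticCurves.QuadraticTwistSelmerPInfty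
import HarnessLib

/-!
# Route `KolyvaginRankRigidityAtTwo`, crux U1 (stmt-BirchSwinnertonDyer-28083): the corank-one collapse is an EQUIVALENCE —
# the rung leaf `Rank1Residual.NonCMTwoConverse` gives back HNT|c1 `HeegnerNonTorsionAtTwoCorankOne` modulo the route's printed inputs

Width seat `bsd-line-krr2-p2` g22 (ONE READER on LINE 17; `--supports stmt-BirchSwinnertonDyer-28083`, helper).  THEOREMS ONLY.

g20's collapse (`…CorankOneCollapse`, p756507) proved `nonCMTwoConverse_of_heegnerNonTorsionCorankOne`: HNT|c1 + the off-habitat item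
`OffHabitatNonSurjTwoConverse` + the printed inputs ⟹ the leaf (rung S3).  This file proves the CONVERSE direction
`heegnerNonTorsionCorankOne_of_nonCMTwoConverse`: the leaf + `PrintedInputsRankOneAtTwo` ⟹ HNT|c1, whence
`heegnerNonTorsionCorankOne_iff_nonCMTwoConverse`: **modulo the off-habitat item and the printed inputs, the habitat organ HNT|c1 (the
rank-one 2-converse over `K` on corank-one Heegner frames) and the rung leaf `NonCMTwoConverse` (the 2-converse over `ℚ` for `r ≤ 1`) are ONE
statement in the kernel.**

Proof of the converse (folklore; Gross–Zagier I (6.1) bookkeeping): on a corank-one frame `corank Sel_{2^∞}(E/ℚ) + corank Sel_{2^∞}(E^{(d_K)}/ℚ) = 1`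
both coranks are `≤ 1`; the leaf applied to `W` and to a globally minimal model `W'` of `E^{(d_K)}` (which is again non-CM — `j` is a twist
invariant — and good-ordinary-or-multiplicative at `2`: `d_K` is ODD so ordinarity at `2` transports (tree `isOrdinaryAt_two_twin_iff_of_odd_discr`,
gk2-p3), and `2` SPLITS in `K` so `d_K ∈ ℚ₂^{×2}` (`isSquare_padic_discr_of_splitsIn`) and multiplicative reduction at `2` transports
(`X11b.hasMultiplicativeReductionAtPrime_quadraticTwist_iff`)) gives `r_an(E) + r_an(E^{(d_K)}) = 1`; modularity (`hasEntireLFunction_rat`,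
`analyticRankEK_eq_add_of`) turns this into `ord_{s=1} L(E/K, s) = 1`; Gross–Zagier in the printed form `analyticRankEK_eq_one_iff_heegner_nonTorsion`
makes the Heegner point `P₀ ∈ E(K)` under the conductor-`1` datum's `P(1)` (`heegnerSystem_exists_isHeegnerPoint_map_eq_derivedPoint_one`, with
Shimura reciprocity at conductor `1` = the tree THEOREMS `phi_heegnerTau_mem_singularModuliField_holds`, `heegnerPointOfConductor_one_galoisConj_holds`)
non-torsion, and `E(K) → E(K[1])` is injective.

READING (route-shape information for the planner / director; nothing is ruled here): together with g20's direction, on the habitat the KRR route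
after the corank-one collapse is the rung S3 MOVED TO `K` — neither weaker nor stronger modulo {`OffHabitatNonSurjTwoConverse`, printed inputs};
any engine for HNT|c1 is an engine for the rung and conversely.  U1's surplus (corank `≥ 3` frames, LINE 17 / S0ʳ) stays off the critical path.
HONEST FRAMING: HNT|c1 and `NonCMTwoConverse` are OPEN (`@[conjecture]` nodes); the printed inputs are named Literature facts, unproved in the tree
(`proof.conditional`); nothing here proves either side; no stub closes; no rung; **BSD is NOT proved.**
References (locators only): [cite: GrossZagier1986, I (6.1), Thm. I.6.3 with V.§2] [cite: GrossLMS1991, §4 (4.1)] [cite: SilvermanAEC2009, X.5 Cor. 5.4,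
VII.5 Prop. 5.1] [cite: NeukirchANT1999, Ch. I (8.5)].
Design: no definitions; default heartbeats; axioms `propext`, `Classical.choice`, `Quot.sound`.
-/

set_option autoImplicit false
-- the Theorems namespace of this sub repeats the summit name by design (D-0017 nested layout)
set_option linter.dupNamespace false

noncomputable section

open scoped Classical

namespace Summit.BirchSwinnertonDyer.BirchSwinnertonDyer.Theorems.KolyvaginAtTwo.CorankOne

open WeierstrassCurve Field Literature.NumberTheory.EllipticCurves
open Summit.BirchSwinnertonDyer.BirchSwinnertonDyer.Theses.KolyvaginRankRigidityAtTwo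
open Summit.BirchSwinnertonDyer.BirchSwinnertonDyer.Theorems.OrdinaryTwistAtTwo

/-! ## §1 The Heegner twin `E^{(d_K)}` on a habitat frame: a globally minimal model is again non-CM and good-ordinary-or-multiplicative at `2` -/

/-- **The twin's habitat clauses at `2`.** For `W/ℚ` globally minimal, non-CM, good ordinary or multiplicative at `2`, and an imaginary quadratic
`K` with `d_K` odd in which `2` splits: every globally minimal model `W'` of `E^{(d_K)}` (`C • W' = W^{(d_K)}`) is non-CM (`j` is a twist invariant)
and good ordinary or multiplicative at `2` (ordinarity at `2` is stable under twists by `d ≡ 1 (mod 4)`; multiplicative reduction at `2` is stable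
under twists by a `2`-adic square, and `d_K ≡ 1 (mod 8)` when `2` splits). [cite: SilvermanAEC2009, X.5 Cor. 5.4, VII.5 Prop. 5.1] -/
theorem twin_not_hasCM_and_goodOrd_or_mult (W : WeierstrassCurve ℚ) [W.IsElliptic] [W.IsGloballyMinimal] (hCM : ¬ W.HasCM)
    (hred : Rank1Residual.GoodOrd W 2 ∨ Rank1Residual.Mult W 2)
    (K : Type) [Field K] [NumberField K] (hK : IsImaginaryQuadratic K) (hodd : Odd (NumberField.discr K))
    (hH2 : SatisfiesHeegnerHypothesis 2 K)
    (W' : WeierstrassCurve ℚ) [W'.IsElliptic] [W'.IsGloballyMinimal] (C : VariableChange ℚ)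
    (hC : C • W' = W.quadraticTwist (NumberField.discr K : ℚ)) :
    ¬ W'.HasCM ∧ (Rank1Residual.GoodOrd W' 2 ∨ Rank1Residual.Mult W' 2) := by
  have hd0 : (NumberField.discr K : ℚ) ≠ 0 := by exact_mod_cast NumberField.discr_ne_zero K
  haveI := W.isElliptic_quadraticTwist hd0
  have hC' : C⁻¹ • W.quadraticTwist (NumberField.discr K : ℚ) = W' := by rw [← hC, inv_smul_smul]
  refine ⟨fun h ↦ ?_, ?_⟩
  · -- `j(W') = j(C • W') = j(W^{(d_K)}) = j(W)`
    have h1 : (C • W').HasCM := (hasCM_iff_of_j_eq (W'.variableChange_j C)).mpr h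
    rw [hC] at h1
    exact not_hasCM_quadraticTwist W hd0 hCM h1
  · rcases hred with hgo | hmu
    · left
      have h := (isOrdinaryAt_two_twin_iff_of_odd_discr W K hK.1 hodd W' ⟨C⁻¹, hC'⟩).mpr hgo
      exact h
    · right
      have hs2 : ((Ideal.span {((2 : ℕ) : ℤ)}).primesOver (NumberField.RingOfIntegers K)).ncard = 2 :=
        hH2 2 Nat.prime_two dvd_rfl
      have hsq : IsSquare ((NumberField.discr K : ℚ) : ℚ_[2]) :=
        Castella2018.TamagawaQuadratic.isSquare_padic_discr_of_splitsIn hK.1 hs2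
      have htw := Summit.BirchSwinnertonDyer.Rank1Residual.X11b.hasMultiplicativeReductionAtPrime_quadraticTwist_iff
        W (q := 2) hd0 (by simpa using hsq)
      have hsm := hasMultiplicativeReductionAtPrime_smul_iff W' C 2
      rw [hC] at hsm
      exact hsm.mp (htw.mpr hmu)

/-! ## §2 The leaf gives HNT|c1 (the converse of g20's collapse) -/

/-- **Leaf ⟹ HNT|c1.** The rung leaf `Rank1Residual.NonCMTwoConverse` and the route's printed inputs `PrintedInputsRankOneAtTwo` (of which only
modularity `hasEntireLFunction_rat` and Gross–Zagier `analyticRankEK_eq_one_iff_heegner_nonTorsion` are used) imply `HeegnerNonTorsionAtTwoCorankOne`: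
on a corank-one frame the leaf gives `r_an(E) + r_an(E^{(d_K)}) = 1 = ord_{s=1} L(E/K, s)`, and Gross–Zagier makes `y_K = P(1)` non-torsion.
CONDITIONAL on two OPEN/printed hypotheses; closes nothing; BSD is NOT proved.
[cite: GrossZagier1986, I (6.1), Thm. I.6.3 with V.§2] [cite: GrossLMS1991, §4 (4.1)] -/
theorem heegnerNonTorsionCorankOne_of_nonCMTwoConverse
    (hS3 : Summit.BirchSwinnertonDyer.BirchSwinnertonDyer.Rank1Residual.NonCMTwoConverse) (hIn : PrintedInputsRankOneAtTwo) :
    HeegnerNonTorsionAtTwoCorankOne := by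
  intro W _ _ hCM hred hsur K _ _ hK _ hHN hodd hne3 htor hH2 Dt β ι hβ _ hc
  obtain ⟨-, -, -, -, hE, hGZ, -⟩ := hIn
  haveI : Fact (Nat.Prime 2) := ⟨Nat.prime_two⟩
  have hd0 : (NumberField.discr K : ℚ) ≠ 0 := by exact_mod_cast NumberField.discr_ne_zero K
  -- a globally minimal model of the twin
  obtain ⟨W', hW'e, hW'm, C, hC⟩ := exists_isGloballyMinimal_smul_eq_quadraticTwist W hd0
  obtain ⟨hCM', hred'⟩ := twin_not_hasCM_and_goodOrd_or_mult W hCM hred K hK hodd hH2 W' C hC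
  -- the leaf on `W` and on `W'`
  have hcW : W.selmerCorank 2 ≤ 1 := by omega
  have hcT : (W.quadraticTwist (NumberField.discr K : ℚ)).selmerCorank 2 ≤ 1 := by omega
  have hcW' : W'.selmerCorank 2 = (W.quadraticTwist (NumberField.discr K : ℚ)).selmerCorank 2 :=
    selmerCorank_eq_of_variableChange 2 hC
  have haW : W.analyticRank = W.selmerCorank 2 := hS3 W hCM hred (W.selmerCorank 2) hcW rfl
  have haW' : W'.analyticRank = W'.selmerCorank 2 := hS3 W' hCM' hred' (W'.selmerCorank 2) (by omega) rfl
  have haT : (W.quadraticTwist (NumberField.discr K : ℚ)).analyticRank = W'.analyticRank := by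
    rw [← hC]; exact WeierstrassCurve.analyticRank_smul W' C
  -- `ord_{s=1} L(E/K, s) = 1`
  have hEK : analyticRankEK W K = 1 := by
    rw [analyticRankEK_eq_add_of hE W K, haT, haW, haW', hcW']
    exact hc
  -- the conductor-one datum and its Heegner point
  obtain ⟨d₁⟩ := exists_kolyvaginHeegnerData_one (phi_heegnerTau_mem_singularModuliField_holds _ W K) hK Dt β ι hβ
  obtain ⟨P₀, hheeg, hP₀⟩ := heegnerSystem_exists_isHeegnerPoint_map_eq_derivedPoint_one
    (heegnerPointOfConductor_one_galoisConj_holds _ W K) hK hHN d₁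
  have hnt : ¬ IsOfFinAddOrder P₀ := (hGZ W _ K hK rfl hHN hheeg).mp hEK
  refine ⟨d₁, fun hfin ↦ hnt ?_⟩
  rw [← hP₀] at hfin
  exact (WeierstrassCurve.Affine.Point.map_injective (W' := W)
    (f := (algebraMap K (ringClassField K ι 1)).toRatAlgHom)).isOfFinAddOrder_iff.mp hfin

/-! ## §3 The collapse is an equivalence -/

/-- **HNT|c1 ⟺ the leaf, modulo the off-habitat item and the printed inputs** (g20's `nonCMTwoConverse_of_heegnerNonTorsionCorankOne` and §2).
Route-shape reading: on the habitat the KRR route after the corank-one collapse is the rung S3 moved to `K`.  CONDITIONAL on the nine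
OPEN/printed hypotheses listed; both sides OPEN; closes nothing; BSD is NOT proved.
[cite: GrossZagier1986, I (6.1), Thm. I.6.3 with V.§2] [cite: Kolyvagin1991MathAnn, §2] -/
theorem heegnerNonTorsionCorankOne_iff_nonCMTwoConverse
    (hR : OffHabitatNonSurjTwoConverse) (hIn : PrintedInputsRankOneAtTwo) (hT : NoTwoTorsionOverK)
    (hf : BFHTwistSupply) (h0 : SimpleZeroTwistSplitAtTwoOfBFH) (hGZK : MultPublishedInputsAtTwo)
    (hMod : NewformOfEllipticCurve) (hHLT : HoffsteinLuoNonvanishingTwist) (hEnt : EntireLFunctionRat) :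
    HeegnerNonTorsionAtTwoCorankOne ↔ Summit.BirchSwinnertonDyer.BirchSwinnertonDyer.Rank1Residual.NonCMTwoConverse :=
  ⟨fun hY ↦ nonCMTwoConverse_of_heegnerNonTorsionCorankOne hY hR hIn hT hf h0 hGZK hMod hHLT hEnt,
    fun hS3 ↦ heegnerNonTorsionCorankOne_of_nonCMTwoConverse hS3 hIn⟩

end Summit.BirchSwinnertonDyer.BirchSwinnertonDyer.Theorems.KolyvaginAtTwo.CorankOne

end
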